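import Summits.KontsevichZagierPeriods.KontsevichZagierPeriods.Theses.RootDecompQuadraticDescent
import Summits.KontsevichZagierPeriods.KontsevichZagierPeriods.Theorems.LowDimensionLowdimBaker0DimLeOne

/-!
# Route RootDecompQuadraticDescent — `BakerFloorOne` (item stmt-KontsevichZagierPeriods-28992) DISCHARGED BY NAME

`BakerFloorOne` (Conjecture 1 for KZ-rational representations of dimensions ≤ 1) is VERBATIM the CLOSED item
stmt-KontsevichZagierPeriods-10622 `Theses.LowDimension.LowdimBaker0DimLeOne`, proved in the tree by
`Summit.KontsevichZagierPeriods.LowDimension.LowdimBaker0DimLeOne.lowdimBaker0DimLeOne_proof` (Baker's theorem through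
`PiBox.Dlog.kzConjecture_of_dim_le_one`). This file is the 1-line discharge asked for by the route writer
(decomp-kz lens-6 gen 5 «Baker floor», critic CLEARED 2026-08-30T06:01:48Z). [Baker 1975, Thm 2.1]
-/

namespace Summit.KontsevichZagierPeriods.RootDecompQuadraticDescent

/-- **BakerFloorOne** (item stmt-KontsevichZagierPeriods-28992) holds: it is the closed item 10622 verbatim. -/
theorem bakerFloorOne_proof :
    Summit.KontsevichZagierPeriods.KontsevichZagierPeriods.Theses.RootDecompQuadraticDescent.BakerFloorOne :=
  Summit.KontsevichZagierPeriods.LowDimension.LowdimBaker0DimLeOne.lowdimBaker0DimLeOne_proof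

end Summit.KontsevichZagierPeriods.RootDecompQuadraticDescent
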